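import Literature.Analysis.FluidPDE.ClassicalLqRateEnergyAbsorb
import Literature.Analysis.FluidPDE.ClassicalSolutionRescale
import Literature.Analysis.FluidPDE.LocalTypeIScaling
import Literature.Analysis.FluidPDE.ChaeWolfDSSTimeAsymptotics
import HarnessLib

/-!
# Chae–Wolf 2017, Theorem 1.1 — Step 2 with a solution-uniform constant, and the
# scale-invariant energy bound at the top points

Analysis/FluidPDE proofs file (theorems only; no definitions, no named facts) on the discharge
path of the named facts `Literature.Analysis.FluidPDE.chaeWolf2017_dss_typeI_decay_ge_nine` /
`Literature.Analysis.FluidPDE.chaeWolf2017_dss_typeI_decay` (`ChaeWolfRemovingDSSDecomposition.lean`,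
`ChaeWolfRemovingDSS.lean`; D. Chae, J. Wolf, *Removing discretely self-similar singularities for
the 3D Navier–Stokes equations*, Comm. PDE 42 (2017) = arXiv:1610.09464, **Theorem 1.1**).

In the range `p ≥ 9` the printed proof (§2, Step 4, arXiv p. 6–7) argues on the rescaled
solutions `v_k(y, s) = ρ_k u(x₀ + ρ_k y, ρ_k² s)` and uses that the local energy bound (2.17),
`‖v_k‖²_{L^∞(−R²,0;L²(B_R))} + ‖∇v_k‖²_{2,Q(0,R)} ≤ C R (‖u‖² + ‖u‖⁴)`, holds **with a constant
independent of `k`**: "Since `(v_k, π_k)` is a solution to the Navier-Stokes equations, using the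
same argument as we have used in the proof of (2.4c), from (2.14) we get for all `0 < R < +∞` the
estimate for the local energy (2.17)". The tree's Step 2 (`ClassicalLqRateEnergyAbsorb.lean`,
`exists_uniform_energy_bound_absorb`) hides the constant behind an existential chosen *after* the
solution; this file re-runs the same argument with the constant chosen *before* the solution
(it depends only on `q, κ, K₀`, the cut-off and `t₀`), and then performs the rescaling:

* `exists_rieszPressure_slice_of_rate_of_const` — the slice pressures (2.4b) with an externally
  given Calderón–Zygmund constant (`exists_rieszPressure` is already uniform);
* `exists_uniform_energy_bound_absorb_unif` — Step 2 with absorption, `∃ Λ ∀ (u, p)`;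
* `exists_unit_energy_classes_unif` — (2.4c) on the unit cylinder `Q₁(0, 0)`, `∃ Λ ∀ (u, p)`;
* `exists_scaleInvariant_energy_bound` — **(2.17) in scale-invariant form**: for a classical
  solution on `ℝ³ × (−∞, 0)` with the *critical* rate `‖u(t)‖_{L^q} ≤ K₀ (−t)^{−(q−3)/(2q)}`
  (the rate (2.13)/(2.4a) of a `λ`-DSS solution), at EVERY top point `(0, x₀)` and EVERY scale
  `r > 0`: `A(r; (0,x₀)) ≤ Λ` and `E(r; (0,x₀)) ≤ Λ` (`cknAEss`, `cknE` with `G = ∇u`), with `Λ`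
  depending on `q, K₀` only — by the Navier–Stokes zoom `v = r u(r² s, x₀ + r y)`
  (`IsClassicalNSSolutionOn.nsRescale_translate`), which keeps `K₀` because the exponent is
  critical, and the covariance `cknAEss_nsZoom`, `cknE_nsZoom`.

## References

* D. Chae, J. Wolf, arXiv:1610.09464, §2 Step 2 (2.4c), (2.4f)–(2.4g) (p. 5–6) and Step 4,
  (2.13)–(2.17) (p. 7). [ChaeWolf2017RemovingDSS]
-/

noncomputable section

open MeasureTheory TopologicalSpace Set Function Filter Metric
open _root_.Topology
open scoped Laplacian InnerProductSpace RealInnerProductSpace ENNReal NNReal ContDiff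

namespace Literature.Analysis.FluidPDE

namespace ChaeWolfEnergy

open PressureNormalisation PressureNormalisationL3

/-! ### The slice pressures with a solution-independent constant -/

section SlicePressure

variable {u : ℝ → (EuclideanSpace ℝ (Fin 3)) → (EuclideanSpace ℝ (Fin 3))}
  {p : ℝ → (EuclideanSpace ℝ (Fin 3)) → ℝ}

/-- **The slice pressures of a classical `L^q` solution with a rate, Calderón–Zygmund constant
given** ((2.4b) with the normalisation of `PressureNormalisationLq`; same proof as
`exists_rieszPressure_slice_of_rate`, the constant `C_q` being supplied by the uniform
`exists_rieszPressure`). [cite: ChaeWolf2017RemovingDSS, §2 (2.4b) (arXiv p. 5)] -/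
theorem exists_rieszPressure_slice_of_rate_of_const {q : ℝ} (hq : 2 < q) {Cq : ℝ≥0}
    (hCq : ∀ U : (EuclideanSpace ℝ (Fin 3)) → (EuclideanSpace ℝ (Fin 3)),
      MemLp U (ENNReal.ofReal (q / 2) * 2) volume →
      ∃ Q : (EuclideanSpace ℝ (Fin 3)) → ℝ, MemLp Q (ENNReal.ofReal (q / 2)) volume ∧
        eLpNorm Q (ENNReal.ofReal (q / 2)) volume ≤
          Cq * eLpNorm U (ENNReal.ofReal (q / 2) * 2) volume ^ 2 ∧
        ∀ φ : (EuclideanSpace ℝ (Fin 3)) → ℝ, ContDiff ℝ (⊤ : ℕ∞) φ → HasCompactSupport φ →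
          ∫ y, Q y * (Δ φ) y = -∫ y, fderiv ℝ (fderiv ℝ φ) y (U y) (U y))
    (hsol : IsClassicalNSSolutionOn (Iio 0) 1 0 u p)
    {κ K₀ T : ℝ} (hκ : 0 ≤ κ) (hK₀ : 0 ≤ K₀)
    (hLq : ∀ t ∈ Ioo (-T) 0, MemLp (u t) (ENNReal.ofReal q) volume)
    (hrate : ∀ t ∈ Ioo (-T) 0,
      eLpNorm (u t) (ENNReal.ofReal q) volume ≤ ENNReal.ofReal (K₀ * (-t) ^ (-κ))) :
    ∀ t ∈ Ioo (-T) 0, ∃ Q : (EuclideanSpace ℝ (Fin 3)) → ℝ,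
      MemLp Q (ENNReal.ofReal (q / 2)) volume ∧
      eLpNorm Q (ENNReal.ofReal (q / 2)) volume ≤
        Cq * eLpNorm (u t) (ENNReal.ofReal q) volume ^ 2 ∧
      (∀ φ : (EuclideanSpace ℝ (Fin 3)) → ℝ, ContDiff ℝ ∞ φ → HasCompactSupport φ →
        ∫ y, Q y * (Δ φ) y = -∫ y, fderiv ℝ (fderiv ℝ φ) y (u t y) (u t y)) ∧
      ∃ C : ℝ, ∀ᵐ x ∂(volume : Measure (EuclideanSpace ℝ (Fin 3))), p t x = Q x + C := by
  have e2 : ENNReal.ofReal (q / 2) * 2 = ENNReal.ofReal q := by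
    rw [← ENNReal.ofReal_ofNat 2, ← ENNReal.ofReal_mul (by linarith)]
    congr 1; ring
  -- the slice pressures everywhere on `(−T, 0)`
  have hex : ∀ s ∈ Ioo (-T) 0, ∃ Q : (EuclideanSpace ℝ (Fin 3)) → ℝ,
      MemLp Q (ENNReal.ofReal (q / 2)) volume ∧
      eLpNorm Q (ENNReal.ofReal (q / 2)) volume ≤ Cq * eLpNorm (u s) (ENNReal.ofReal q) volume ^ 2 ∧
      ∀ φ : (EuclideanSpace ℝ (Fin 3)) → ℝ, ContDiff ℝ ∞ φ → HasCompactSupport φ →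
        ∫ y, Q y * (Δ φ) y = -∫ y, fderiv ℝ (fderiv ℝ φ) y (u s y) (u s y) := by
    intro s hs
    have hu : MemLp (u s) (ENNReal.ofReal (q / 2) * 2) volume := by rw [e2]; exact hLq s hs
    obtain ⟨Q, hQ, hQb, hQeq⟩ := hCq (u s) hu
    rw [e2] at hQb
    exact ⟨Q, hQ, hQb, hQeq⟩
  choose! Qt hQt hQtb hQteq using hex
  intro t ht
  refine ⟨Qt t, hQt t ht, hQtb t ht, hQteq t ht, ?_⟩
  -- the subinterval `(−T, t/2)` and the uniform bound there
  have ht2 : t < t / 2 := by linarith [ht.2]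
  have ht20 : t / 2 < 0 := by linarith [ht.2]
  have hsub : Ioo (-T) (t / 2) ⊆ Ioo (-T) 0 := fun s hs => ⟨hs.1, hs.2.trans ht20⟩
  have hsol' : IsClassicalNSSolutionOn (Ioo (-T) (t / 2)) 1 0 u p :=
    hsol.mono (fun s hs => (hs.2.trans ht20 : s < 0)) (uniqueDiffOn_Ioo _ _)
  set m : ℝ := K₀ * (-(t / 2)) ^ (-κ) with hm
  have hM : ∀ s ∈ Ioo (-T) (t / 2), eLpNorm (u s) (ENNReal.ofReal q) volume ≤ (m.toNNReal : ℝ≥0∞) := by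
    intro s hs
    refine (hrate s (hsub hs)).trans ?_
    rw [ENNReal.ofReal]
    refine ENNReal.coe_le_coe.2 (Real.toNNReal_le_toNNReal ?_)
    refine mul_le_mul_of_nonneg_left ?_ hK₀
    exact Real.rpow_le_rpow_of_nonpos (by linarith) (by linarith [hs.2]) (by linarith)
  have hP : ∀ s ∈ Ioo (-T) (t / 2), eLpNorm (Qt s) (ENNReal.ofReal (q / 2)) volume ≤
      ((Cq * m.toNNReal ^ 2 : ℝ≥0) : ℝ≥0∞) := by
    intro s hs
    calc eLpNorm (Qt s) (ENNReal.ofReal (q / 2)) volume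
        ≤ Cq * eLpNorm (u s) (ENNReal.ofReal q) volume ^ 2 := hQtb s (hsub hs)
      _ ≤ Cq * (m.toNNReal : ℝ≥0∞) ^ 2 := by gcongr; exact hM s hs
      _ = ((Cq * m.toNNReal ^ 2 : ℝ≥0) : ℝ≥0∞) := by push_cast; ring
  exact pressure_ae_eq_add_const (le_of_lt one_pos) hsol' hq hM
    (fun s hs => hQt s (hsub hs)) hP (fun s hs => hQteq s (hsub hs)) ⟨ht.1, ht2⟩

end SlicePressure

/-! ### Step 2 with a solution-uniform constant -/

section Energy

/-- **The local energy stays bounded up to `t = 0`, with a constant independent of the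
solution** (Chae–Wolf 2017, Step 2 with absorption, `p ≥ 4`; the uniformity used for the
rescaled solutions `v_k` in (2.17)). Given `4 ≤ q`, `0 ≤ κ`, `2κ < 1`, `K₀ ≥ 0`, a smooth cut-off
`χ` with `|χ| ≤ 1` supported in `B̄(x₀, R)`, and `−T < t₀ < 0`, there is `Λ` such that for EVERY
classical solution `(u, p)` of the unforced system (`ν = 1`) on `ℝ³ × (−∞, 0)` with
`u(t) ∈ L^q` and `‖u(t)‖_{L^q} ≤ K₀(−t)^{−κ}` on `(−T, 0)`:
`∫ χ²|u(t)|² + 2∫_{t₀}^{t}∫ |∇u|²χ² ≤ Λ` for all `t ∈ [t₀, 0)`. Same proof as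
`exists_uniform_energy_bound_absorb`, with `e(t₀) ≤ |B̄|^{1−2/q} K₀² (−t₀)^{−2κ}`.
[cite: ChaeWolf2017RemovingDSS, §2 Step 2, (2.4f)–(2.4g)–(2.4c) (arXiv p. 5–6) and Step 4 (2.17) (p. 7)] -/
theorem exists_uniform_energy_bound_absorb_unif {q : ℝ} (hq : 4 ≤ q) {κ K₀ T : ℝ} (hκ : 0 ≤ κ)
    (hκ2 : 2 * κ < 1) (hK₀ : 0 ≤ K₀)
    {χ : (EuclideanSpace ℝ (Fin 3)) → ℝ} {x₀ : (EuclideanSpace ℝ (Fin 3))} {R : ℝ}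
    (hχ : ContDiff ℝ ∞ χ) (hχsupp : tsupport χ ⊆ closedBall x₀ R) (hχ1 : ∀ x, |χ x| ≤ 1)
    {t₀ : ℝ} (ht₀ : -T < t₀) (ht₀0 : t₀ < 0) :
    ∃ Λ : ℝ, ∀ (u : ℝ → (EuclideanSpace ℝ (Fin 3)) → (EuclideanSpace ℝ (Fin 3)))
      (p : ℝ → (EuclideanSpace ℝ (Fin 3)) → ℝ), IsClassicalNSSolutionOn (Iio 0) 1 0 u p →
      (∀ t ∈ Ioo (-T) 0, MemLp (u t) (ENNReal.ofReal q) volume) →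
      (∀ t ∈ Ioo (-T) 0,
        eLpNorm (u t) (ENNReal.ofReal q) volume ≤ ENNReal.ofReal (K₀ * (-t) ^ (-κ))) →
      ∀ t ∈ Ico t₀ 0,
        (∫ x, χ x ^ 2 * ‖u t x‖ ^ 2) +
          2 * ∫ s in t₀..t, ∫ x, frobeniusNormSq (fderiv ℝ (u s) x) * χ x ^ 2 ≤ Λ := by
  have hS : IsOpen (Iio (0 : ℝ)) := isOpen_Iio
  have hq2 : (2 : ℝ) < q := by linarith
  have hq2' : (2 : ℝ) ≤ q := by linarith
  set φ : (EuclideanSpace ℝ (Fin 3)) → ℝ := fun y => χ y ^ 2 with hφ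
  -- regularity of the cut-offs and bounds of their derivatives (solution independent)
  have hχc : HasCompactSupport χ :=
    IsCompact.of_isClosed_subset (isCompact_closedBall x₀ R) (isClosed_tsupport _) hχsupp
  have hχ1' : ContDiff ℝ 1 χ := hχ.of_le (by norm_cast)
  have hφs : ContDiff ℝ ∞ φ := hχ.pow 2
  have hφ2 : ContDiff ℝ 2 φ := hφs.of_le (by norm_cast)
  have hφc : HasCompactSupport φ := hχc.comp_left (g := fun r : ℝ => r ^ 2) (by simp)
  have hφnn : ∀ x, 0 ≤ φ x := fun x => sq_nonneg _
  have hφle : ∀ x, φ x ≤ 1 := fun x => by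
    show χ x ^ 2 ≤ 1
    rw [← sq_abs]
    exact pow_le_one₀ (abs_nonneg _) (hχ1 x)
  have hΔc : Continuous (Δ φ) := FluidPDE.continuous_laplacian hφ2
  have hΔs : HasCompactSupport (Δ φ) := hφc.mono' fun x hx => by
    contrapose! hx
    simp [FluidPDE.laplacian_eq_zero_of_notMem_tsupport hx]
  obtain ⟨CΔ, hCΔ⟩ := hΔc.bounded_above_of_compact_support hΔs
  obtain ⟨CD, hCD⟩ := (hχ1'.continuous_fderiv one_ne_zero).bounded_above_of_compact_support
    (hχc.fderiv (𝕜 := ℝ))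
  have hCΔ0 : 0 ≤ CΔ := (norm_nonneg _).trans (hCΔ 0)
  have hCD0 : 0 ≤ CD := (norm_nonneg _).trans (hCD 0)
  have hCΔ' : ∀ x, |(Δ φ) x| ≤ CΔ := fun x => by rw [← Real.norm_eq_abs]; exact hCΔ x
  -- the Calderón–Zygmund constant (solution independent)
  have hq22 : 1 < q / 2 := by linarith
  obtain ⟨Cq, hCq⟩ := exists_rieszPressure hq22
  -- the constants
  set V : ℝ := (volume : Measure (EuclideanSpace ℝ (Fin 3))).real (closedBall x₀ R) with hV
  have hV0 : 0 ≤ V := measureReal_nonneg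
  set A : ℝ := CΔ * V ^ (1 - 2 / q) * K₀ ^ 2 with hA
  set B : ℝ := 2 * CD * Real.sqrt (V ^ (1 - 4 / q)) * K₀ ^ 2 +
    4 * CD * Real.sqrt (V ^ (1 - 4 / q)) * (Cq : ℝ) * K₀ ^ 2 with hB
  have hA0 : 0 ≤ A := by positivity
  have hB0 : 0 ≤ B := by positivity
  -- the majorant integral `J = ∫_{t₀}^0 (−s)^{−2κ}`
  have imaj : IntervalIntegrable (fun s : ℝ => (-s) ^ (-(2 * κ))) volume t₀ 0 :=
    intervalIntegrable_rpow_neg_two hκ2 t₀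
  set J : ℝ := ∫ s in t₀..0, (-s) ^ (-(2 * κ)) with hJ
  have hJ0 : 0 ≤ J := intervalIntegral.integral_nonneg ht₀0.le fun s hs =>
    Real.rpow_nonneg (by linarith [hs.2]) _
  -- the initial-energy bound `E₀` and the final constant
  set E₀ : ℝ := V ^ (1 - 2 / q) * (K₀ * (-t₀) ^ (-κ)) ^ 2 with hE₀
  have hE₀0 : 0 ≤ E₀ := by positivity
  set Λ₁ : ℝ := 2 * (E₀ + A * J) + (B * J) ^ 2 with hΛ₁
  have hΛ₁0 : 0 ≤ Λ₁ := by positivity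
  refine ⟨E₀ + (A + B * Real.sqrt Λ₁) * J, fun u p hsol hLq hrate t ht => ?_⟩
  -- ## the solution: slice pressures
  have hQex := exists_rieszPressure_slice_of_rate_of_const hq2 hCq hsol hκ hK₀ hLq hrate
  choose! Qt hQt hQtb hQteq Ct hCt using hQex
  -- energy, flux, dissipation
  set e : ℝ → ℝ := fun s => ∫ x, χ x ^ 2 * ‖u s x‖ ^ 2 with he
  have he0 : ∀ s, 0 ≤ e s := fun s => integral_nonneg fun x => by positivity
  set Flux : ℝ → ℝ := fun s => ∫ x, ((1 : ℝ) * ((Δ φ) x * ‖u s x‖ ^ 2) +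
    fderiv ℝ φ x (u s x) * ‖u s x‖ ^ 2 + 2 * (p s x * fderiv ℝ φ x (u s x))) with hFlux
  have hbound : ∀ s ∈ Ioo (-T) 0, ‖Flux s‖ ≤ (A + B * Real.sqrt (e s)) * (-s) ^ (-(2 * κ)) := by
    intro s hs
    have hs0 : 0 < -s := by linarith [hs.2]
    set M : ℝ≥0 := (K₀ * (-s) ^ (-κ)).toNNReal with hM
    have hMval : (M : ℝ) = K₀ * (-s) ^ (-κ) :=
      Real.coe_toNNReal _ (mul_nonneg hK₀ (Real.rpow_nonneg hs0.le _))
    have hvM : eLpNorm (u s) (ENNReal.ofReal q) volume ≤ M := hrate s hs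
    set P : ℝ≥0 := Cq * M ^ 2 with hP
    have hQP : eLpNorm (Qt s) (ENNReal.ofReal (q / 2)) volume ≤ P := by
      calc eLpNorm (Qt s) (ENNReal.ofReal (q / 2)) volume
          ≤ Cq * eLpNorm (u s) (ENNReal.ofReal q) volume ^ 2 := hQtb s hs
        _ ≤ Cq * (M : ℝ≥0∞) ^ 2 := by gcongr
        _ = (P : ℝ≥0∞) := by rw [hP]; push_cast; ring
    have hs' : s ∈ Iio (0 : ℝ) := hs.2
    have key := abs_flux_cutoff_sq_le hχ hχsupp hCΔ' hCD hCΔ0 hCD0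
      ((hsol.contDiff_velocity hs').of_le (by norm_cast)) (hsol.divFree s hs') hq hvM
      (hsol.contDiff_pressure hs').continuous (hQt s hs) hQP (hCt s hs) (le_of_lt one_pos)
    rw [Real.norm_eq_abs]
    refine key.trans (le_of_eq ?_)
    have i2 : (K₀ * (-s) ^ (-κ)) ^ 2 = K₀ ^ 2 * (-s) ^ (-(2 * κ)) := by
      rw [mul_pow, ← Real.rpow_natCast ((-s) ^ (-κ)) 2, ← Real.rpow_mul hs0.le]
      congr 1; congr 1; push_cast; ring
    have hPval : (P : ℝ) = Cq * (K₀ * (-s) ^ (-κ)) ^ 2 := by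
      rw [hP, NNReal.coe_mul, NNReal.coe_pow, hMval]
    rw [hMval, hPval, i2, hA, hB]
    ring
  -- continuity of the energy, the flux and the dissipation on `(−∞, 0)`
  have ce : ContinuousOn e (Iio 0) := fun s hs =>
    (hsol.hasDerivAt_integral_cutoff_norm_sq hS hφs hφc hs).continuousAt.continuousWithinAt
  have cF : ContinuousOn Flux (Iio 0) := hsol.continuousOn_integral_flux_cutoff hφs hφc
  -- the initial energy `e t₀ ≤ E₀`
  have het₀ : e t₀ ≤ E₀ := by
    have ht₀' : t₀ ∈ Ioo (-T) 0 := ⟨ht₀, ht₀0⟩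
    have hnt₀ : 0 < -t₀ := by linarith
    set M₀ : ℝ≥0 := (K₀ * (-t₀) ^ (-κ)).toNNReal with hM₀
    have hM₀val : (M₀ : ℝ) = K₀ * (-t₀) ^ (-κ) :=
      Real.coe_toNNReal _ (mul_nonneg hK₀ (Real.rpow_nonneg hnt₀.le _))
    have hvM₀ : eLpNorm (u t₀) (ENNReal.ofReal q) volume ≤ M₀ := hrate t₀ ht₀'
    have huc : Continuous (u t₀) := (hsol.contDiff_velocity (ht₀0 : t₀ < 0)).continuous
    have hχcont : Continuous χ := hχ.continuous
    have hout : ∀ y, y ∉ closedBall x₀ R → χ y = 0 := fun y hy =>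
      image_eq_zero_of_notMem_tsupport fun h => hy (hχsupp h)
    have h1 : e t₀ = ∫ x in closedBall x₀ R, χ x ^ 2 * ‖u t₀ x‖ ^ 2 := by
      rw [he]
      refine (setIntegral_eq_integral_of_forall_compl_eq_zero fun x hx => ?_).symm
      rw [hout x hx]; ring
    have hint1 : IntegrableOn (fun x => χ x ^ 2 * ‖u t₀ x‖ ^ 2) (closedBall x₀ R) volume :=
      (((hχcont.pow 2).mul (huc.norm.pow 2)).continuousOn.integrableOn_compact
        (isCompact_closedBall x₀ R))
    have hint2 : IntegrableOn (fun x => ‖u t₀ x‖ ^ 2) (closedBall x₀ R) volume :=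
      ((huc.norm.pow 2).continuousOn.integrableOn_compact (isCompact_closedBall x₀ R))
    have h2 : ∫ x in closedBall x₀ R, χ x ^ 2 * ‖u t₀ x‖ ^ 2 ≤ ∫ x in closedBall x₀ R, ‖u t₀ x‖ ^ 2 := by
      refine setIntegral_mono_on hint1 hint2 measurableSet_closedBall fun x _ => ?_
      exact mul_le_of_le_one_left (sq_nonneg _) (hφle x)
    have h3 := setIntegral_norm_sq_le x₀ R huc hq2' hvM₀
    rw [hM₀val] at h3
    rw [h1, hE₀]
    exact h2.trans h3
  -- ## the bound at `t`
  have ht0 : t < 0 := ht.2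
  have hI : Icc t₀ t ⊆ Iio 0 := fun s hs => lt_of_le_of_lt hs.2 ht0
  -- the maximum of `e` over `[t₀, t]`
  obtain ⟨sm, hsm, hmax⟩ := (isCompact_Icc (a := t₀) (b := t)).exists_isMaxOn
    (nonempty_Icc.2 ht.1) (ce.mono hI)
  set Mx : ℝ := e sm with hMx
  have hMx0 : 0 ≤ Mx := he0 sm
  have heMx : ∀ σ ∈ Icc t₀ t, e σ ≤ Mx := fun σ hσ => hmax hσ
  -- the integrated identity on `[t₀, s]` for `s ∈ [t₀, t]`
  have step : ∀ s ∈ Icc t₀ t, e s + 2 * ∫ σ in t₀..s, ∫ x, frobeniusNormSq (fderiv ℝ (u σ) x) * χ x ^ 2 ≤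
      e t₀ + (A + B * Real.sqrt Mx) * J := by
    intro s hs
    have hs0 : s < 0 := lt_of_le_of_lt hs.2 ht0
    have hIs : Icc t₀ s ⊆ Iio 0 := fun σ hσ => lt_of_le_of_lt hσ.2 hs0
    have hIs' : uIcc t₀ s ⊆ Iio 0 := by rwa [uIcc_of_le hs.1]
    have hIT : Ioo t₀ s ⊆ Ioo (-T) 0 := fun σ hσ => ⟨ht₀.trans hσ.1, hσ.2.trans hs0⟩
    have hid := hsol.local_energy_identity_cutoff hS hφs hφc hs.1 hIs
    have iF : IntervalIntegrable Flux volume t₀ s := (cF.mono hIs').intervalIntegrable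
    have imaj' : IntervalIntegrable (fun σ : ℝ => (A + B * Real.sqrt Mx) * (-σ) ^ (-(2 * κ))) volume t₀ s := by
      refine (imaj.mono_set ?_).const_mul _
      rw [uIcc_of_le hs.1, uIcc_of_le ht₀0.le]
      exact Icc_subset_Icc le_rfl hs0.le
    have hF1 : ∫ σ in t₀..s, Flux σ ≤ ∫ σ in t₀..s, (A + B * Real.sqrt Mx) * (-σ) ^ (-(2 * κ)) := by
      calc ∫ σ in t₀..s, Flux σ ≤ ‖∫ σ in t₀..s, Flux σ‖ := Real.le_norm_self _
        _ ≤ ∫ σ in t₀..s, ‖Flux σ‖ := intervalIntegral.norm_integral_le_integral_norm hs.1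
        _ ≤ ∫ σ in t₀..s, (A + B * Real.sqrt Mx) * (-σ) ^ (-(2 * κ)) := by
            refine intervalIntegral.integral_mono_on_of_le_Ioo hs.1 iF.norm imaj' fun σ hσ => ?_
            refine (hbound σ (hIT hσ)).trans ?_
            have h1 : Real.sqrt (e σ) ≤ Real.sqrt Mx :=
              Real.sqrt_le_sqrt (heMx σ ⟨hσ.1.le, hσ.2.le.trans hs.2⟩)
            have h2 : 0 ≤ (-σ) ^ (-(2 * κ)) := Real.rpow_nonneg (by linarith [hσ.2]) _
            have h3 : A + B * Real.sqrt (e σ) ≤ A + B * Real.sqrt Mx := by gcongr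
            exact mul_le_mul_of_nonneg_right h3 h2
    have hF2 : ∫ σ in t₀..s, (A + B * Real.sqrt Mx) * (-σ) ^ (-(2 * κ)) ≤ (A + B * Real.sqrt Mx) * J := by
      rw [intervalIntegral.integral_const_mul]
      refine mul_le_mul_of_nonneg_left ?_ (by positivity)
      refine intervalIntegral.integral_mono_interval le_rfl hs.1 hs0.le ?_ imaj
      exact (ae_restrict_iff' measurableSet_Ioc).2 (Eventually.of_forall fun σ hσ =>
        Real.rpow_nonneg (by linarith [hσ.2]) _)
    simp only [mul_one] at hid
    have : e s = ∫ x, χ x ^ 2 * ‖u s x‖ ^ 2 := rfl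
    have : e t₀ = ∫ x, χ x ^ 2 * ‖u t₀ x‖ ^ 2 := rfl
    linarith
  -- the absorption: `Mx ≤ E₀ + A J + (B J) √Mx`
  have hGnn : ∀ s ∈ Icc t₀ t, 0 ≤ ∫ σ in t₀..s, ∫ x, frobeniusNormSq (fderiv ℝ (u σ) x) * χ x ^ 2 :=
    fun s hs => intervalIntegral.integral_nonneg hs.1 fun σ _ =>
      integral_nonneg fun x => mul_nonneg (frobeniusNormSq_nonneg _) (sq_nonneg _)
  have hMxle : Mx ≤ (E₀ + A * J) + (B * J) * Real.sqrt Mx := by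
    have h1 := step sm hsm
    have h2 := hGnn sm hsm
    rw [hMx]
    nlinarith
  have hMxΛ : Mx ≤ Λ₁ := le_of_le_add_mul_sqrt hMx0 hMxle
  -- conclusion at `t`
  have h1 := step t ⟨ht.1, le_rfl⟩
  have h2 : (A + B * Real.sqrt Mx) * J ≤ (A + B * Real.sqrt Λ₁) * J := by
    gcongr
  have : e t = ∫ x, χ x ^ 2 * ‖u t x‖ ^ 2 := rfl
  linarith

/-- **(2.4c) on the unit cylinder with a solution-uniform constant.** Given `4 ≤ q`, `0 ≤ κ`,
`2κ < 1`, `K₀ ≥ 0` and `T > 1`, there is `Λ` such that EVERY classical solution `(u, p)` of the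
unforced system (`ν = 1`) on `ℝ³ × (−∞, 0)` with `u(t) ∈ L^q` and
`‖u(t)‖_{L^q} ≤ K₀(−t)^{−κ}` on `(−T, 0)` satisfies `∫_{B(0,1)} |u(t)|² ≤ Λ` for all
`t ∈ (−1, 0)` and `∫∫_{Q₁(0,0)} |∇u|² ≤ Λ` (the uniformity behind (2.17)).
[cite: ChaeWolf2017RemovingDSS, §2 Step 2 (2.4c) (arXiv p. 6) and Step 4 (2.17) (p. 7)] -/
theorem exists_unit_energy_classes_unif {q : ℝ} (hq : 4 ≤ q) {κ K₀ T : ℝ} (hκ : 0 ≤ κ)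
    (hκ2 : 2 * κ < 1) (hK₀ : 0 ≤ K₀) (hT : 1 < T) :
    ∃ Λ : ℝ≥0, ∀ (u : ℝ → (EuclideanSpace ℝ (Fin 3)) → (EuclideanSpace ℝ (Fin 3)))
      (p : ℝ → (EuclideanSpace ℝ (Fin 3)) → ℝ), IsClassicalNSSolutionOn (Iio 0) 1 0 u p →
      (∀ t ∈ Ioo (-T) 0, MemLp (u t) (ENNReal.ofReal q) volume) →
      (∀ t ∈ Ioo (-T) 0,
        eLpNorm (u t) (ENNReal.ofReal q) volume ≤ ENNReal.ofReal (K₀ * (-t) ^ (-κ))) →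
      (∀ t ∈ Ioo (-1 ^ 2) 0,
        ∫⁻ x in ball (0 : EuclideanSpace ℝ (Fin 3)) 1, ‖u t x‖ₑ ^ 2 ≤ Λ) ∧
      ∫⁻ w in parabolicCylinder 1 ((0 : ℝ), (0 : EuclideanSpace ℝ (Fin 3))),
        ENNReal.ofReal (frobeniusNormSq (fderiv ℝ (u w.1) w.2)) ≤ Λ := by
  have hS : IsOpen (Iio (0 : ℝ)) := isOpen_Iio
  -- the cut-off `χ` and the weight `χ²`
  let χ : ContDiffBump (0 : EuclideanSpace ℝ (Fin 3)) := ⟨1, 2, one_pos, by norm_num⟩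
  have hχs : ContDiff ℝ ∞ χ := χ.contDiff
  have hχsupp : tsupport χ ⊆ closedBall (0 : EuclideanSpace ℝ (Fin 3)) 2 := by rw [χ.tsupport_eq]
  have hχ1 : ∀ x, |(χ : EuclideanSpace ℝ (Fin 3) → ℝ) x| ≤ 1 := fun x => by
    rw [abs_of_nonneg χ.nonneg]; exact χ.le_one
  have hφnn : ∀ x : EuclideanSpace ℝ (Fin 3), 0 ≤ χ x ^ 2 := fun x => sq_nonneg _
  have hφ1 : ∀ x ∈ ball (0 : EuclideanSpace ℝ (Fin 3)) 1, χ x ^ 2 = 1 := fun x hx => by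
    rw [χ.one_of_mem_closedBall (ball_subset_closedBall hx), one_pow]
  have hφs : ContDiff ℝ ∞ (fun x : EuclideanSpace ℝ (Fin 3) => χ x ^ 2) := hχs.pow 2
  have hφc : HasCompactSupport (fun x : EuclideanSpace ℝ (Fin 3) => χ x ^ 2) :=
    χ.hasCompactSupport.comp_left (g := fun r : ℝ => r ^ 2) (by simp)
  -- the initial time `t₀`
  set t₀ : ℝ := -((T + 1) / 2) with ht₀
  have ht₀T : -T < t₀ := by rw [ht₀]; linarith
  have ht₀ρ : t₀ < -1 := by rw [ht₀]; linarith
  have ht₀0 : t₀ < 0 := by rw [ht₀]; linarith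
  obtain ⟨Λ, hΛ⟩ := exists_uniform_energy_bound_absorb_unif hq hκ hκ2 hK₀ hχs hχsupp hχ1 ht₀T ht₀0
  refine ⟨Λ.toNNReal, fun u p hsol hLq hrate => ?_⟩
  have hΛu := hΛ u p hsol hLq hrate
  -- names for energy and dissipation
  set e : ℝ → ℝ := fun t => ∫ x, χ x ^ 2 * ‖u t x‖ ^ 2 with he
  set G : ℝ → ℝ := fun s => ∫ x, frobeniusNormSq (fderiv ℝ (u s) x) * χ x ^ 2 with hG
  have hGnn : ∀ s, 0 ≤ G s := fun s =>
    integral_nonneg fun x => mul_nonneg (frobeniusNormSq_nonneg _) (hφnn x)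
  have henn : ∀ t, 0 ≤ e t := fun t => integral_nonneg fun x => mul_nonneg (hφnn x) (sq_nonneg _)
  have cG : ContinuousOn G (Iio 0) :=
    hsol.continuousOn_integral_dissipation_cutoff hS hφs.continuous hφc
  have hIG : ∀ t ∈ Ico t₀ 0, 0 ≤ ∫ s in t₀..t, G s := fun t ht =>
    intervalIntegral.integral_nonneg ht.1 fun s _ => hGnn s
  have he_le : ∀ t ∈ Ico t₀ 0, e t ≤ Λ := fun t ht => by
    have := hΛu t ht; have := hIG t ht; linarith
  have hG_le : ∀ t ∈ Ico t₀ 0, ∫ s in t₀..t, G s ≤ Λ / 2 := fun t ht => by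
    have := hΛu t ht; have := henn t; linarith
  refine ⟨fun t ht => ?_, ?_⟩
  · -- ## the `L^∞_t L²_x` class
    have ht1 : -1 < t := by have := ht.1; norm_num at this; exact this
    have ht' : t ∈ Ico t₀ 0 := ⟨(ht₀ρ.trans ht1).le, ht.2⟩
    have huc : Continuous (u t) := (hsol.contDiff_velocity (ht.2 : t < 0)).continuous
    have hball : IntegrableOn (fun x => ‖u t x‖ ^ 2) (ball (0 : EuclideanSpace ℝ (Fin 3)) 1) volume :=
      ((huc.norm.pow 2).continuousOn.integrableOn_compact (isCompact_closedBall _ _)).mono_set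
        ball_subset_closedBall
    have hφu : Integrable (fun x => χ x ^ 2 * ‖u t x‖ ^ 2) volume :=
      (hφs.continuous.mul (huc.norm.pow 2)).integrable_of_hasCompactSupport hφc.mul_right
    have h1 : ∫ x in ball (0 : EuclideanSpace ℝ (Fin 3)) 1, ‖u t x‖ ^ 2 ≤ e t := by
      rw [he, ← integral_indicator measurableSet_ball]
      refine integral_mono (hball.integrable_indicator measurableSet_ball) hφu fun x => ?_
      by_cases hx : x ∈ ball (0 : EuclideanSpace ℝ (Fin 3)) 1
      · rw [indicator_of_mem hx, hφ1 x hx, one_mul]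
      · rw [indicator_of_notMem hx]; exact mul_nonneg (hφnn x) (sq_nonneg _)
    have h2 : ∫⁻ x in ball (0 : EuclideanSpace ℝ (Fin 3)) 1, ‖u t x‖ₑ ^ 2 =
        ENNReal.ofReal (∫ x in ball (0 : EuclideanSpace ℝ (Fin 3)) 1, ‖u t x‖ ^ 2) := by
      rw [ofReal_integral_eq_lintegral_ofReal hball (ae_of_all _ fun x => sq_nonneg _)]
      refine lintegral_congr fun x => ?_
      rw [← ofReal_norm, ← ENNReal.ofReal_pow (norm_nonneg _)]
    rw [h2, ENNReal.ofReal]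
    exact ENNReal.coe_le_coe.2 (Real.toNNReal_le_toNNReal (h1.trans (he_le t ht')))
  · -- ## the dissipation class
    set F : ℝ × (EuclideanSpace ℝ (Fin 3)) → ℝ≥0∞ := fun w =>
      ENNReal.ofReal (frobeniusNormSq (fderiv ℝ (u w.1) w.2)) with hF
    have hu1 : ContDiffOn ℝ 1 (uncurry u) (Iio 0 ×ˢ univ) := hsol.smooth_velocity.of_le (by norm_cast)
    have cDu : ContinuousOn (fun z : ℝ × (EuclideanSpace ℝ (Fin 3)) => fderiv ℝ (u z.1) z.2)
        (Iio 0 ×ˢ univ) := continuousOn_fderiv_slice_of_contDiffOn hu1 hS.uniqueDiffOn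
    have cF : ContinuousOn F (Iio 0 ×ˢ univ) :=
      ENNReal.continuous_ofReal.comp_continuousOn (continuous_frobeniusNormSq_clm.comp_continuousOn cDu)
    -- the bound on truncated cylinders
    have hcyl : ∀ t ∈ Ioo (-1 ^ 2) 0,
        ∫⁻ w in Ioo (0 - 1 ^ 2) t ×ˢ ball (0 : EuclideanSpace ℝ (Fin 3)) 1, F w ≤
          ENNReal.ofReal (Λ / 2) := by
      intro t ht
      have ht1 : -1 < t := by have := ht.1; norm_num at this; exact this
      have ht' : t ∈ Ico t₀ 0 := ⟨(ht₀ρ.trans ht1).le, ht.2⟩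
      have hsub : Ioo (0 - 1 ^ 2) t ×ˢ ball (0 : EuclideanSpace ℝ (Fin 3)) 1 ⊆
          Iio (0 : ℝ) ×ˢ (univ : Set (EuclideanSpace ℝ (Fin 3))) :=
        prod_mono (fun s hs => (hs.2.trans ht.2 : s < 0)) (subset_univ _)
      have hFm : AEMeasurable F ((volume.restrict (Ioo (0 - 1 ^ 2) t)).prod
          (volume.restrict (ball (0 : EuclideanSpace ℝ (Fin 3)) 1))) := by
        rw [Measure.prod_restrict]
        exact (cF.mono hsub).aemeasurable (measurableSet_Ioo.prod measurableSet_ball)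
      have hvol : (volume : Measure (ℝ × (EuclideanSpace ℝ (Fin 3)))) =
          (volume : Measure ℝ).prod (volume : Measure (EuclideanSpace ℝ (Fin 3))) := rfl
      rw [hvol, ← Measure.prod_restrict, lintegral_prod _ hFm]
      -- inner integral
      have hinner : ∀ s ∈ Ioo (0 - 1 ^ 2) t,
          ∫⁻ x in ball (0 : EuclideanSpace ℝ (Fin 3)) 1, F (s, x) ≤ ENNReal.ofReal (G s) := by
        intro s hs
        have hs0 : s < 0 := hs.2.trans ht.2
        have cfs : Continuous fun x => frobeniusNormSq (fderiv ℝ (u s) x) :=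
          continuous_frobeniusNormSq_clm.comp
            (((hsol.contDiff_velocity hs0).of_le
              (by norm_cast : (1 : WithTop ℕ∞) ≤ ((⊤ : ℕ∞) : WithTop ℕ∞))).continuous_fderiv one_ne_zero)
        have hint : Integrable (fun x => frobeniusNormSq (fderiv ℝ (u s) x) * χ x ^ 2) volume :=
          (cfs.mul hφs.continuous).integrable_of_hasCompactSupport hφc.mul_left
        calc ∫⁻ x in ball (0 : EuclideanSpace ℝ (Fin 3)) 1, F (s, x)
            = ∫⁻ x in ball (0 : EuclideanSpace ℝ (Fin 3)) 1,
                ENNReal.ofReal (frobeniusNormSq (fderiv ℝ (u s) x) * χ x ^ 2) := by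
              refine setLIntegral_congr_fun measurableSet_ball fun x hx => ?_
              simp only [hF, hφ1 x hx, mul_one]
          _ ≤ ∫⁻ x, ENNReal.ofReal (frobeniusNormSq (fderiv ℝ (u s) x) * χ x ^ 2) :=
              lintegral_mono' Measure.restrict_le_self le_rfl
          _ = ENNReal.ofReal (G s) := by
              rw [hG, ofReal_integral_eq_lintegral_ofReal hint]
              exact ae_of_all _ fun x => mul_nonneg (frobeniusNormSq_nonneg _) (hφnn x)
      -- outer integral
      have hIcc : Icc (0 - 1 ^ 2) t ⊆ Iio 0 := fun s hs => lt_of_le_of_lt hs.2 ht.2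
      have iG : IntegrableOn G (Ioo (0 - 1 ^ 2) t) volume :=
        ((cG.mono hIcc).integrableOn_compact isCompact_Icc).mono_set Ioo_subset_Icc_self
      calc ∫⁻ s in Ioo (0 - 1 ^ 2) t, ∫⁻ x in ball (0 : EuclideanSpace ℝ (Fin 3)) 1, F (s, x)
          ≤ ∫⁻ s in Ioo (0 - 1 ^ 2) t, ENNReal.ofReal (G s) :=
            setLIntegral_mono' measurableSet_Ioo fun s hs => hinner s hs
        _ = ENNReal.ofReal (∫ s in Ioo (0 - 1 ^ 2) t, G s) :=
            (ofReal_integral_eq_lintegral_ofReal iG (ae_of_all _ fun s => hGnn s)).symm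
        _ = ENNReal.ofReal (∫ s in (0 - 1 ^ 2)..t, G s) := by
            rw [intervalIntegral.integral_of_le (by norm_num; linarith), integral_Ioc_eq_integral_Ioo]
        _ ≤ ENNReal.ofReal (∫ s in t₀..t, G s) := by
            refine ENNReal.ofReal_le_ofReal ?_
            refine intervalIntegral.integral_mono_interval (by norm_num; linarith) (by norm_num; linarith)
              le_rfl ?_ ?_
            · exact ae_of_all _ fun s => hGnn s
            · refine ((cG.mono ?_).intervalIntegrable)
              rw [uIcc_of_le ht'.1]
              exact fun s hs => lt_of_le_of_lt hs.2 ht.2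
        _ ≤ ENNReal.ofReal (Λ / 2) := ENNReal.ofReal_le_ofReal (hG_le t ht')
    -- exhaustion of the cylinder
    set tn : ℕ → ℝ := fun n => -(1 / ((n : ℝ) + 2)) with htn
    have htn_mem : ∀ n, tn n ∈ Ioo (-1 ^ 2 : ℝ) 0 := fun n => by
      have h2 : (0 : ℝ) < (n : ℝ) + 2 := by positivity
      refine ⟨?_, ?_⟩
      · rw [htn]
        have : (1 : ℝ) / ((n : ℝ) + 2) < 1 := by
          rw [div_lt_iff₀ h2]; linarith
        have h' : -(1 : ℝ) ^ 2 < -(1 / ((n : ℝ) + 2)) := by linarith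
        exact h'
      · rw [htn]; exact neg_neg_of_pos (div_pos one_pos h2)
    have hmono : Monotone fun n => Ioo (0 - 1 ^ 2 : ℝ) (tn n) ×ˢ ball (0 : EuclideanSpace ℝ (Fin 3)) 1 := by
      intro m n hmn
      refine prod_mono (Ioo_subset_Ioo le_rfl ?_) subset_rfl
      rw [htn]
      have h2 : (0 : ℝ) < (m : ℝ) + 2 := by positivity
      have : 1 / ((n : ℝ) + 2) ≤ 1 / ((m : ℝ) + 2) :=
        div_le_div_of_nonneg_left zero_le_one h2 (by exact_mod_cast Nat.add_le_add_right hmn 2)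
      linarith
    have hunion : (⋃ n, Ioo (0 - 1 ^ 2 : ℝ) (tn n) ×ˢ ball (0 : EuclideanSpace ℝ (Fin 3)) 1) =
        parabolicCylinder 1 ((0 : ℝ), (0 : EuclideanSpace ℝ (Fin 3))) := by
      rw [parabolicCylinder, ← iUnion_prod_const]
      congr 1
      ext s
      simp only [mem_iUnion, mem_Ioo]
      constructor
      · rintro ⟨n, h1, h2⟩
        exact ⟨h1, h2.trans (htn_mem n).2⟩
      · rintro ⟨h1, h2⟩
        have hs : 0 < -s := by linarith
        obtain ⟨n, hn⟩ := exists_nat_gt (1 / -s)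
        refine ⟨n, h1, ?_⟩
        rw [htn]
        have h2' : (0 : ℝ) < (n : ℝ) + 2 := by positivity
        have : 1 / ((n : ℝ) + 2) < -s := by
          rw [div_lt_iff₀ h2']
          rw [div_lt_iff₀ hs] at hn
          nlinarith
        linarith
    rw [← hunion, setLIntegral_iUnion_of_directed F hmono.directed_le]
    refine (iSup_le fun n => hcyl (tn n) (htn_mem n)).trans ?_
    rw [ENNReal.ofReal]
    refine ENNReal.coe_le_coe.2 (Real.toNNReal_le_toNNReal ?_)
    have : 0 ≤ Λ := (henn t₀).trans (he_le t₀ ⟨le_rfl, ht₀0⟩)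
    linarith

end Energy

end ChaeWolfEnergy

/-! ### The scale-invariant energy bound at the top points -/

namespace ChaeWolfDecay

/-- **(2.17) in scale-invariant form: `A(r; (0,x₀)) + E(r; (0,x₀))` is bounded uniformly in the
centre and the scale.** Given `4 ≤ q` and `K₀ ≥ 0` there is `Λ` such that for every classical
solution `(u, p)` of the unforced Navier–Stokes system (`ν = 1`) on `ℝ³ × (−∞, 0)` with
`u(t) ∈ L^q` and the critical rate `‖u(t)‖_{L^q} ≤ K₀ (−t)^{−(q−3)/(2q)}` for all `t < 0` (the rate
(2.4a)/(2.13) of a `λ`-DSS solution), every `x₀ ∈ ℝ³` and every `r > 0`: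
`A(r; (0,x₀)) = ess sup_{−r²<t<0} r⁻¹∫_{B(x₀,r)}|u(t)|² ≤ Λ` and
`E(r; (0,x₀)) = r⁻¹ ∫∫_{Q_r(0,x₀)} |∇u|² ≤ Λ`. Proof: the zoom `v(s,y) = r u(r²s, x₀ + r y)` is a
classical solution on `(−∞, 0)` (`IsClassicalNSSolutionOn.nsRescale_translate`) with
`‖v(s)‖_q = r^{1−3/q} ‖u(r²s)‖_q ≤ K₀ (−s)^{−(q−3)/(2q)}` — the same constant, the exponent being
critical — so the unit-cylinder bound `exists_unit_energy_classes_unif` applies to `v`, and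
`A, E` are invariant under the zoom (`cknAEss_nsZoom`, `cknE_nsZoom`).
[cite: ChaeWolf2017RemovingDSS, §2 Step 4, (2.13)–(2.17) (arXiv p. 7)] -/
theorem exists_scaleInvariant_energy_bound {q : ℝ} (hq : 4 ≤ q) {K₀ : ℝ} (hK₀ : 0 ≤ K₀) :
    ∃ Λ : ℝ≥0, ∀ (u : ℝ → (EuclideanSpace ℝ (Fin 3)) → (EuclideanSpace ℝ (Fin 3)))
      (p : ℝ → (EuclideanSpace ℝ (Fin 3)) → ℝ), IsClassicalNSSolutionOn (Iio 0) 1 0 u p →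
      (∀ t < 0, MemLp (u t) (ENNReal.ofReal q) volume) →
      (∀ t < 0, eLpNorm (u t) (ENNReal.ofReal q) volume ≤
        ENNReal.ofReal (K₀ * (-t) ^ (-((q - 3) / (2 * q))))) →
      ∀ (x₀ : EuclideanSpace ℝ (Fin 3)) (r : ℝ), 0 < r →
        cknAEss r ((0 : ℝ), x₀) u ≤ Λ ∧
        cknE r ((0 : ℝ), x₀) (fun t x => fderiv ℝ (u t) x) ≤ Λ := by
  set κ : ℝ := (q - 3) / (2 * q) with hκ
  have hq0 : 0 < q := by linarith
  have hκ0 : 0 ≤ κ := by rw [hκ]; exact div_nonneg (by linarith) (by linarith)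
  have hκ2 : 2 * κ < 1 := by
    have h1 : 2 * κ = (q - 3) / q := by
      rw [hκ, mul_div_assoc', div_eq_div_iff (by positivity) hq0.ne']
      ring
    rw [h1, div_lt_one hq0]
    linarith
  obtain ⟨Λ, hΛ⟩ := ChaeWolfEnergy.exists_unit_energy_classes_unif hq hκ0 hκ2 hK₀ (T := 2)
    (by norm_num)
  refine ⟨Λ, fun u p hsol hLq hrate x₀ r hr => ?_⟩
  -- the zoomed solution
  set v : ℝ → (EuclideanSpace ℝ (Fin 3)) → (EuclideanSpace ℝ (Fin 3)) :=
    r • stPull (r ^ 2) r 0 x₀ u with hv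
  set pv : ℝ → (EuclideanSpace ℝ (Fin 3)) → ℝ := r ^ 2 • stPull (r ^ 2) r 0 x₀ p with hpv
  have hr2 : 0 < r ^ 2 := by positivity
  have hneg : ∀ s < (0 : ℝ), r ^ 2 * s < 0 := fun s hs => mul_neg_of_pos_of_neg hr2 hs
  have hvsol : IsClassicalNSSolutionOn (Iio 0) 1 0 v pv := by
    have key := hsol.nsRescale_translate hr 0 x₀
    have hS : ((fun s => (0 : ℝ) + r ^ 2 * s) ⁻¹' Iio (0 : ℝ)) = Iio 0 := by
      ext s
      simp only [mem_preimage, mem_Iio, zero_add]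
      constructor
      · intro h
        by_contra hs
        push Not at hs
        have := mul_nonneg hr2.le hs
        linarith
      · intro h
        exact hneg s h
    rw [hS, smul_stPull_zero] at key
    exact key
  -- slices of `v` are rescaled translated slices of `u`
  have hslice : ∀ s, v s = nsRescaleData r (fun x => u (r ^ 2 * s) (x₀ + x)) := by
    intro s; funext y
    simp only [hv, smul_stPull_apply, nsRescaleData_apply, zero_add]
  have htr : ∀ s, (fun x => u (r ^ 2 * s) (x₀ + x)) = u (r ^ 2 * s) ∘ (fun x => x₀ + x) :=
    fun s => rfl
  have hmp : MeasurePreserving (fun x : EuclideanSpace ℝ (Fin 3) => x₀ + x) volume volume :=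
    measurePreserving_add_left volume x₀
  have hLqv : ∀ s < (0 : ℝ), MemLp (v s) (ENNReal.ofReal q) volume := by
    intro s hs
    rw [hslice s]
    refine memLp_nsRescaleData ?_ hr.ne'
    rw [htr s]
    exact (hLq _ (hneg s hs)).comp_measurePreserving hmp
  have hratev : ∀ s < (0 : ℝ), eLpNorm (v s) (ENNReal.ofReal q) volume ≤
      ENNReal.ofReal (K₀ * (-s) ^ (-κ)) := by
    intro s hs
    have hs0 : 0 < -s := by linarith
    rw [hslice s, eLpNorm_nsRescaleData_of_ne_zero _ _ hr.ne', finrank_euclideanSpace_fin,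
      Real.enorm_eq_ofReal hr.le, abs_of_pos (by positivity), ofReal_mul_ofReal_rpow_eq hr,
      ENNReal.toReal_ofReal hq0.le, htr s,
      eLpNorm_comp_measurePreserving (hLq _ (hneg s hs)).1 hmp]
    calc ENNReal.ofReal (r ^ (1 - 3 / q)) * eLpNorm (u (r ^ 2 * s)) (ENNReal.ofReal q) volume
        ≤ ENNReal.ofReal (r ^ (1 - 3 / q)) * ENNReal.ofReal (K₀ * (-(r ^ 2 * s)) ^ (-κ)) := by
          gcongr
          exact hrate _ (hneg s hs)
      _ = ENNReal.ofReal (K₀ * (-s) ^ (-κ)) := by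
          rw [← ENNReal.ofReal_mul (Real.rpow_nonneg hr.le _)]
          congr 1
          have e1 : -(r ^ 2 * s) = r ^ 2 * (-s) := by ring
          have e2 : r ^ (1 - 3 / q) * (r ^ 2) ^ (-κ) = 1 := by
            rw [← Real.rpow_natCast r 2, ← Real.rpow_mul hr.le, ← Real.rpow_add hr]
            have : 1 - 3 / q + ((2 : ℕ) : ℝ) * -κ = 0 := by
              rw [hκ]; push_cast; field_simp; ring
            rw [this, Real.rpow_zero]
          rw [e1, Real.mul_rpow hr2.le hs0.le]
          calc r ^ (1 - 3 / q) * (K₀ * ((r ^ 2) ^ (-κ) * (-s) ^ (-κ)))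
              = K₀ * (r ^ (1 - 3 / q) * (r ^ 2) ^ (-κ)) * (-s) ^ (-κ) := by ring
            _ = K₀ * (-s) ^ (-κ) := by rw [e2, mul_one]
  -- the unit-cylinder bounds for `v`
  obtain ⟨hA1, hE1⟩ := hΛ v pv hvsol (fun s hs => hLqv s hs.2) (fun s hs => hratev s hs.2)
  -- the centre of the zoom
  have hz : stAffine (r ^ 2) r 0 x₀ (0 : ℝ × EuclideanSpace ℝ (Fin 3)) = ((0 : ℝ), x₀) :=
    Prod.ext (by simp [stAffine]) (by simp [stAffine])
  constructor
  · -- `A(r; (0,x₀))[u] = A(1; 0)[v]`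
    have hAe : cknAEss r ((0 : ℝ), x₀) u = cknAEss 1 0 v := by
      have := cknAEss_nsZoom hr one_pos 0 x₀ 0 u
      rw [mul_one, hz] at this
      rw [hv]
      exact this.symm
    rw [hAe, cknAEss]
    refine essSup_le_of_ae_le _ ?_
    refine (ae_restrict_iff' measurableSet_Ioo).2 (ae_of_all _ fun t ht => ?_)
    have ht' : t ∈ Ioo (-1 ^ 2 : ℝ) 0 := by simpa using ht
    have e1 : (ENNReal.ofReal (1 : ℝ))⁻¹ = 1 := by rw [ENNReal.ofReal_one, inv_one]
    dsimp only
    rw [e1, one_mul]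
    simpa using hA1 t ht'
  · -- `E(r; (0,x₀))[∇u] = E(1; 0)[∇v]`
    have hEe : cknE r ((0 : ℝ), x₀) (fun t x => fderiv ℝ (u t) x) =
        cknE 1 0 (r ^ 2 • stPull (r ^ 2) r 0 x₀ (fun t x => fderiv ℝ (u t) x)) := by
      have := cknE_nsZoom hr one_pos 0 x₀ 0 (fun t x => fderiv ℝ (u t) x)
      rw [mul_one, hz] at this
      exact this.symm
    have e1 : (ENNReal.ofReal (1 : ℝ))⁻¹ = 1 := by rw [ENNReal.ofReal_one, inv_one]
    rw [hEe, cknE, e1, one_mul]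
    -- on the cylinder the rescaled gradient is the gradient of `v`
    have hcongr : ∫⁻ w in parabolicCylinder 1 (0 : ℝ × EuclideanSpace ℝ (Fin 3)),
        ENNReal.ofReal (frobeniusNormSq
          ((r ^ 2 • stPull (r ^ 2) r 0 x₀ (fun t x => fderiv ℝ (u t) x)) w.1 w.2)) =
        ∫⁻ w in parabolicCylinder 1 ((0 : ℝ), (0 : EuclideanSpace ℝ (Fin 3))),
          ENNReal.ofReal (frobeniusNormSq (fderiv ℝ (v w.1) w.2)) := by
      refine setLIntegral_congr_fun (isOpen_parabolicCylinder _ _).measurableSet fun w hw => ?_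
      rw [mem_parabolicCylinder] at hw
      have hs : w.1 < 0 := by have := hw.1.2; simpa using this
      have ht : (0 : ℝ) + r ^ 2 * w.1 < 0 := by rw [zero_add]; exact hneg _ hs
      have hdiff : Differentiable ℝ (stPull (r ^ 2) r 0 x₀ u w.1) :=
        differentiable_stPull_slice ((hsol.contDiff_velocity ht).differentiable (by simp))
      have hfd : fderiv ℝ (v w.1) w.2 = r ^ 2 • fderiv ℝ (u (0 + r ^ 2 * w.1)) (x₀ + r • w.2) := by
        have e2 : v w.1 = r • stPull (r ^ 2) r 0 x₀ u w.1 := rfl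
        rw [e2, fderiv_const_smul (hdiff w.2), fderiv_stPull, smul_smul, sq]
      rw [hfd]
      rfl
    rw [hcongr]
    exact hE1

end ChaeWolfDecay

end Literature.Analysis.FluidPDE

end
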